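import Mathlib.Analysis.Calculus.ParametricIntegral
import Mathlib.Analysis.Calculus.ContDiff.FiniteDimension
import Mathlib.Analysis.Calculus.MeanValue
import Mathlib.MeasureTheory.Integral.IntervalIntegral.FundThmCalculus
import Mathlib.MeasureTheory.Measure.Haar.NormedSpace
import Mathlib.Topology.UniformSpace.UniformApproximation
import Literature.Analysis.FluidPDE.HarmonicMeanValue
import Literature.Analysis.FluidPDE.TaoEnergyLocalisation
import Literature.Analysis.FluidPDE.WholeSpaceIBP
import HarnessLib

/-!
# Probing harmonic functions at large scales

Analysis/FluidPDE support file for the discharge of Tao's pressure-normalisation lemma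
(`FluidPDE/NormalisedPressureProofs`, Tao 2011 = arXiv:1108.1165, Lemma 4.1 (i)). The printed
proof tests the harmonic part `h(t)` of the pressure against a rescaled radial bump `χ_R` and
lets `R → ∞`; this file provides the scale-free tools for that step, on a finite-dimensional
real inner product space `E` unless stated otherwise:

* **dilation and reflection calculus** for `fderiv` and `Δ` (`fderiv2_const_smul_comp_smul`,
  `fderiv_comp_const_sub`, `laplacian_const_smul_comp_smul`, …, on top of Mathlib's
  `fderiv_comp_smul`), with no differentiability hypotheses (both sides are junk together);
* **differentiation under the integral sign** for `x ↦ ∫ k(z) • g(x - z) dz` with `k ∈ L¹`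
  vanishing off a ball and `g ∈ Cⁿ` (`contDiff_integral_smul_comp_sub`,
  `laplacian_integral_mul_comp_sub`);
* the **unit-mass radial bumps** `probeBump R = (m R^d)⁻¹ θ(R⁻¹ ·)` (`θ = taoCutoff 2 1`, the
  tree's smooth radial cutoff, `= 1` on `|x| ≤ 1`, `= 0` on `|x| ≥ 2`; `m = ∫ θ`), their
  scaling, support and derivative bounds;
* the **mean-value formula for the gradient**: for `η` harmonic on `E`,
  `Dη(x₀) a = ∫ ∂ₐχ_R(z) η(x₀ - z) dz` for every `R > 0` (Gilbarg–Trudinger Thm 2.1 in the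
  weighted form of `HarmonicMeanValue`, differentiated under the integral and integrated by
  parts) — the identity by which Tao converts `∫∫ ∇h χ_R` into `∫ ∇h(t, 0) dt`;
* a **real-variable uniqueness lemma**: if `g` on `(a, b)` admits, for every `ε > 0`, a `C¹`
  function `W` with `|W| ≤ ε` and `|g + W'| ≤ ε`, then `g = 0` (the form in which
  "`∫_{t₁}^{t₂} ∇h(t,0) dt = 0` for all `t₁ < t₂`, hence `∇h(t, 0) = 0`" is used, the boundary
  terms `W(tᵢ) = ∫ u(tᵢ) χ_R` being `o(1)` rather than zero).

## References

* D. Gilbarg, N. S. Trudinger, *Elliptic partial differential equations of second order*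
  (Springer, 2001 reprint), Thm 2.1 and (2.19) (gradient of a harmonic function via the mean
  value theorem).
* T. Tao, *Localisation and compactness properties of the Navier–Stokes global regularity
  problem*, Anal. PDE 6 (2013) = arXiv:1108.1165, §4, proof of Lemma 4.1.
-/

noncomputable section

open MeasureTheory Set Filter Metric Topology InnerProductSpace Function Real
open scoped RealInnerProductSpace Laplacian ContDiff

namespace Literature.Analysis.FluidPDE

/-! ### Derivatives under homotheties, translations and reflections -/

section Homothety

variable {E : Type*} [NormedAddCommGroup E] [NormedSpace ℝ E]
variable {F : Type*} [NormedAddCommGroup F] [NormedSpace ℝ F]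

/-- `D(a • f(b ·)) = z ↦ (a b) • Df(b z)` (no differentiability needed; Mathlib's
`fderiv_comp_smul` for the homothety, `fderiv_const_smul_field` for the constant). The
hypothesis `b ≠ 0` is kept because the `Δ`/second-order corollaries below are used only for
genuine dilations. [folklore] -/
theorem fderiv_const_smul_comp_smul (f : E → F) (a : ℝ) {b : ℝ} (_hb : b ≠ 0) :
    fderiv ℝ (fun w => a • f (b • w)) = fun z => (a * b) • fderiv ℝ f (b • z) := by
  funext z
  have : (fun w => a • f (b • w)) = a • fun w => f (b • w) := rfl
  rw [this, fderiv_const_smul_field, Pi.smul_apply, _root_.fderiv_comp_smul, smul_smul]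

/-- `D²(a • f(b ·)) = z ↦ (a b²) • D²f(b z)` for `b ≠ 0`. [folklore] -/
theorem fderiv2_const_smul_comp_smul (f : E → F) (a : ℝ) {b : ℝ} (hb : b ≠ 0) :
    fderiv ℝ (fderiv ℝ (fun w => a • f (b • w))) =
      fun z => (a * b ^ 2) • fderiv ℝ (fderiv ℝ f) (b • z) := by
  rw [fderiv_const_smul_comp_smul f a hb, fderiv_const_smul_comp_smul (fderiv ℝ f) (a * b) hb]
  funext z
  rw [sq, mul_assoc]

/-- `D(f(x - ·))(y) = -Df(x - y)`. [folklore] -/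
theorem fderiv_comp_const_sub (f : E → F) (x y : E) :
    fderiv ℝ (fun w => f (x - w)) y = -fderiv ℝ f (x - y) := by
  have h1 : (fun w => f (x - w)) = fun w => (1 : ℝ) • (fun v => f (x + v)) ((-1 : ℝ) • w) := by
    funext w; simp [sub_eq_add_neg]
  rw [h1, fderiv_const_smul_comp_smul (fun v => f (x + v)) 1 (b := -1) (by norm_num)]
  simp only [one_mul, neg_smul, one_smul]
  rw [fderiv_comp_add_left, ← sub_eq_add_neg]

/-- `D²(f(x - ·))(y) = D²f(x - y)` (the two sign changes cancel). [folklore] -/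
theorem fderiv2_comp_const_sub (f : E → F) (x y : E) :
    fderiv ℝ (fderiv ℝ (fun w => f (x - w))) y = fderiv ℝ (fderiv ℝ f) (x - y) := by
  have h1 : (fun w => f (x - w)) = fun w => (1 : ℝ) • (fun v => f (x + v)) ((-1 : ℝ) • w) := by
    funext w; simp [sub_eq_add_neg]
  rw [h1, fderiv2_const_smul_comp_smul (fun v => f (x + v)) 1 (b := -1) (by norm_num)]
  simp only [one_mul, neg_one_sq, one_smul, neg_smul]
  have h2 : fderiv ℝ (fun v => f (x + v)) = fun v => fderiv ℝ f (x + v) := by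
    funext v; exact fderiv_comp_add_left x
  rw [h2, fderiv_comp_add_left, ← sub_eq_add_neg]

end Homothety

section HomothetyLaplacian

variable {E : Type*} [NormedAddCommGroup E] [InnerProductSpace ℝ E] [FiniteDimensional ℝ E]
variable {F : Type*} [NormedAddCommGroup F] [NormedSpace ℝ F]

/-- `Δ(a • f(b ·))(z) = (a b²) • (Δf)(b z)` for `b ≠ 0`. [folklore] -/
theorem laplacian_const_smul_comp_smul (f : E → F) (a : ℝ) {b : ℝ} (hb : b ≠ 0) (z : E) :
    (Δ (fun w => a • f (b • w))) z = (a * b ^ 2) • (Δ f) (b • z) := by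
  rw [laplacian_eq_iteratedFDeriv_stdOrthonormalBasis,
    laplacian_eq_iteratedFDeriv_stdOrthonormalBasis]
  simp only [iteratedFDeriv_two_apply, Finset.smul_sum]
  refine Finset.sum_congr rfl fun i _ => ?_
  rw [fderiv2_const_smul_comp_smul f a hb]
  simp

/-- `Δ(f(x - ·))(y) = (Δf)(x - y)`. [folklore] -/
theorem laplacian_comp_const_sub (f : E → F) (x y : E) :
    (Δ (fun w => f (x - w))) y = (Δ f) (x - y) := by
  rw [laplacian_eq_iteratedFDeriv_stdOrthonormalBasis,
    laplacian_eq_iteratedFDeriv_stdOrthonormalBasis]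
  simp only [iteratedFDeriv_two_apply, fderiv2_comp_const_sub]

end HomothetyLaplacian

/-! ### Differentiation under the integral sign: `L¹` kernels vanishing off a ball -/

section KernelSmooth

variable {E : Type*} [NormedAddCommGroup E] [InnerProductSpace ℝ E] [FiniteDimensional ℝ E]
  [MeasurableSpace E] [BorelSpace E]
variable {F : Type*} [NormedAddCommGroup F] [NormedSpace ℝ F]

omit [MeasurableSpace E] [BorelSpace E] [FiniteDimensional ℝ E]
  [InnerProductSpace ℝ E] [NormedSpace ℝ F] in
/-- A continuous function is bounded on the translates `x - z`, `x ∈ B̄(x₀, 1)`, `z ∈ B̄(0, ρ)`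
(proper spaces: closed balls are compact). [folklore] -/
theorem exists_bound_comp_sub [NormedSpace ℝ E] [ProperSpace E] {g : E → F} (hg : Continuous g)
    (x₀ : E) (ρ : ℝ) :
    ∃ C, 0 ≤ C ∧ ∀ x ∈ closedBall x₀ 1, ∀ z ∈ closedBall (0 : E) ρ, ‖g (x - z)‖ ≤ C := by
  obtain ⟨C, hC⟩ := (isCompact_closedBall x₀ (1 + |ρ|)).exists_bound_of_continuousOn
    hg.continuousOn
  refine ⟨max C 0, le_max_right _ _, fun x hx z hz => (hC _ ?_).trans (le_max_left _ _)⟩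
  rw [mem_closedBall, dist_eq_norm] at hx ⊢
  rw [mem_closedBall_zero_iff] at hz
  calc ‖x - z - x₀‖ = ‖(x - x₀) - z‖ := by abel_nf
    _ ≤ ‖x - x₀‖ + ‖z‖ := norm_sub_le _ _
    _ ≤ 1 + |ρ| := add_le_add hx (hz.trans (le_abs_self ρ))

variable {k : E → ℝ} {ρ : ℝ}

/-- Integrability of `z ↦ k(z) • g(x - z)` for `k ∈ L¹` vanishing off a ball and `g`
continuous. [folklore] -/
theorem integrable_smul_comp_sub (hk : Integrable k) (hkρ : ∀ z, ρ < ‖z‖ → k z = 0)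
    {g : E → F} (hg : Continuous g) (x : E) : Integrable fun z => k z • g (x - z) := by
  obtain ⟨C, -, hC⟩ := exists_bound_comp_sub hg x ρ
  refine Integrable.mono' (hk.norm.mul_const C)
    (hk.aestronglyMeasurable.smul (hg.comp (continuous_const.sub continuous_id)).aestronglyMeasurable)
    (Eventually.of_forall fun z => ?_)
  by_cases hz : ‖z‖ ≤ ρ
  · rw [norm_smul]
    exact mul_le_mul_of_nonneg_left (hC x (mem_closedBall_self zero_le_one) z
      (mem_closedBall_zero_iff.2 hz)) (norm_nonneg _)
  · rw [hkρ z (not_le.1 hz), zero_smul, norm_zero, norm_zero, zero_mul]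

/-- **Continuity** of `x ↦ ∫ k(z) • g(x - z) dz` for `k ∈ L¹` vanishing off a ball and `g`
continuous (dominated convergence). [folklore] -/
theorem continuous_integral_smul_comp_sub (hk : Integrable k) (hkρ : ∀ z, ρ < ‖z‖ → k z = 0)
    {g : E → F} (hg : Continuous g) : Continuous fun x => ∫ z, k z • g (x - z) := by
  refine continuous_iff_continuousAt.2 fun x₀ => ?_
  obtain ⟨C, -, hC⟩ := exists_bound_comp_sub hg x₀ ρ
  refine continuousAt_of_dominated (bound := fun z => ‖k z‖ * C) ?_ ?_ ?_ ?_
  · exact Eventually.of_forall fun x => (hk.aestronglyMeasurable.smul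
      (hg.comp (continuous_const.sub continuous_id)).aestronglyMeasurable)
  · filter_upwards [closedBall_mem_nhds x₀ one_pos] with x hx
    refine Eventually.of_forall fun z => ?_
    by_cases hz : ‖z‖ ≤ ρ
    · rw [norm_smul]
      exact mul_le_mul_of_nonneg_left (hC x hx z (mem_closedBall_zero_iff.2 hz)) (norm_nonneg _)
    · rw [hkρ z (not_le.1 hz), zero_smul, norm_zero, norm_zero, zero_mul]
  · exact hk.norm.mul_const C
  · exact Eventually.of_forall fun z =>
      (continuous_const.smul (hg.comp (continuous_id.sub continuous_const))).continuousAt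

/-- **Differentiation under the integral sign** for `x ↦ ∫ k(z) • g(x - z) dz`, `k ∈ L¹`
vanishing off a ball, `g ∈ C¹`: the derivative is `∫ k(z) • Dg(x - z) dz`. [folklore] -/
theorem hasFDerivAt_integral_smul_comp_sub (hk : Integrable k) (hkρ : ∀ z, ρ < ‖z‖ → k z = 0)
    {g : E → F} (hg : ContDiff ℝ 1 g) (x₀ : E) :
    HasFDerivAt (fun x => ∫ z, k z • g (x - z)) (∫ z, k z • fderiv ℝ g (x₀ - z)) x₀ := by
  have hgc : Continuous g := hg.continuous
  have hDg : Continuous (fderiv ℝ g) := hg.continuous_fderiv one_ne_zero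
  obtain ⟨C, -, hC⟩ := exists_bound_comp_sub hDg x₀ ρ
  refine hasFDerivAt_integral_of_dominated_of_fderiv_le (F' := fun x z => k z • fderiv ℝ g (x - z))
    (bound := fun z => ‖k z‖ * C) (closedBall_mem_nhds x₀ one_pos) ?_ ?_ ?_ ?_ ?_ ?_
  · exact Eventually.of_forall fun x => (hk.aestronglyMeasurable.smul
      (hgc.comp (continuous_const.sub continuous_id)).aestronglyMeasurable)
  · exact integrable_smul_comp_sub hk hkρ hgc x₀
  · exact hk.aestronglyMeasurable.smul
      (hDg.comp (continuous_const.sub continuous_id)).aestronglyMeasurable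
  · refine Eventually.of_forall fun z x hx => ?_
    by_cases hz : ‖z‖ ≤ ρ
    · rw [norm_smul]
      exact mul_le_mul_of_nonneg_left (hC x hx z (mem_closedBall_zero_iff.2 hz)) (norm_nonneg _)
    · rw [hkρ z (not_le.1 hz), zero_smul, norm_zero, norm_zero, zero_mul]
  · exact hk.norm.mul_const C
  · refine Eventually.of_forall fun z x _ => ?_
    have h1 : HasFDerivAt (fun x : E => g (x - z)) (fderiv ℝ g (x - z)) x := by
      have := ((hg.differentiable one_ne_zero) (x - z)).hasFDerivAt.comp x
        (hasFDerivAt_sub_const z)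
      rwa [ContinuousLinearMap.comp_id] at this
    exact h1.const_smul (k z)

/-- The derivative formula for `x ↦ ∫ k(z) • g(x - z) dz`. [folklore] -/
theorem fderiv_integral_smul_comp_sub (hk : Integrable k) (hkρ : ∀ z, ρ < ‖z‖ → k z = 0)
    {g : E → F} (hg : ContDiff ℝ 1 g) (x : E) :
    fderiv ℝ (fun x => ∫ z, k z • g (x - z)) x = ∫ z, k z • fderiv ℝ g (x - z) :=
  (hasFDerivAt_integral_smul_comp_sub hk hkρ hg x).fderiv

/-- The directional derivative formula `∂ₐ ∫ k(z) • g(x - z) dz = ∫ k(z) • ∂ₐg(x - z) dz`.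
[folklore] -/
theorem fderiv_integral_smul_comp_sub_apply [CompleteSpace F] (hk : Integrable k)
    (hkρ : ∀ z, ρ < ‖z‖ → k z = 0)
    {g : E → F} (hg : ContDiff ℝ 1 g) (x a : E) :
    fderiv ℝ (fun x => ∫ z, k z • g (x - z)) x a = ∫ z, k z • fderiv ℝ g (x - z) a := by
  rw [fderiv_integral_smul_comp_sub hk hkρ hg x, ContinuousLinearMap.integral_apply]
  · simp only [FunLike.coe_smul, Pi.smul_apply]
  · exact integrable_smul_comp_sub hk hkρ (hg.continuous_fderiv one_ne_zero) x

/-- **`Cⁿ` regularity** of `x ↦ ∫ k(z) • g(x - z) dz` for `k ∈ L¹` vanishing off a ball and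
`g ∈ Cⁿ` (no support or growth condition on `g`). [folklore] -/
theorem contDiff_integral_smul_comp_sub [CompleteSpace F] (hk : Integrable k)
    (hkρ : ∀ z, ρ < ‖z‖ → k z = 0) :
    ∀ (n : ℕ) {g : E → F}, ContDiff ℝ n g → ContDiff ℝ n fun x => ∫ z, k z • g (x - z) := by
  intro n
  induction n with
  | zero =>
    intro g hg
    exact contDiff_zero.2 (continuous_integral_smul_comp_sub hk hkρ hg.continuous)
  | succ n ih =>
    intro g hg
    have hg1 : ContDiff ℝ 1 g := hg.of_le (by exact_mod_cast Nat.succ_le_succ (Nat.zero_le n))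
    rw [show ((n + 1 : ℕ) : WithTop ℕ∞) = (n : WithTop ℕ∞) + 1 by push_cast; rfl,
      contDiff_succ_iff_fderiv_apply]
    refine ⟨fun x => (hasFDerivAt_integral_smul_comp_sub hk hkρ hg1 x).differentiableAt,
      fun h => ?_, fun a => ?_⟩
    · exact absurd h (by exact_mod_cast WithTop.natCast_ne_top n)
    · have hga : ContDiff ℝ n fun w => fderiv ℝ g w a := by
        have := (show ((n + 1 : ℕ) : WithTop ℕ∞) = (n : WithTop ℕ∞) + 1 by push_cast; rfl) ▸ hg
        exact (contDiff_succ_iff_fderiv_apply.1 this).2.2 a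
      have heq : (fun x => fderiv ℝ (fun x => ∫ z, k z • g (x - z)) x a) =
          fun x => ∫ z, k z • (fun w => fderiv ℝ g w a) (x - z) :=
        funext fun x => fderiv_integral_smul_comp_sub_apply hk hkρ hg1 x a
      rw [heq]
      exact ih hga

/-- **The Laplacian passes under the integral**: for `k ∈ L¹` vanishing off a ball and a
real `g ∈ C²`, `Δ(∫ k(z) g(· - z) dz)(x) = ∫ k(z) (Δg)(x - z) dz`. [folklore] -/
theorem laplacian_integral_mul_comp_sub (hk : Integrable k) (hkρ : ∀ z, ρ < ‖z‖ → k z = 0)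
    {g : E → ℝ} (hg : ContDiff ℝ 2 g) (x : E) :
    (Δ (fun x => ∫ z, k z * g (x - z))) x = ∫ z, k z * (Δ g) (x - z) := by
  set b := stdOrthonormalBasis ℝ E
  have hg1 : ContDiff ℝ 1 g := hg.of_le one_le_two
  have hgi : ∀ i, ContDiff ℝ 1 fun w => fderiv ℝ g w (b i) := fun i =>
    (hg.fderiv_right (m := 1) le_rfl).clm_apply contDiff_const
  have hQ : ContDiff ℝ 2 fun x => ∫ z, k z * g (x - z) :=
    contDiff_integral_smul_comp_sub hk hkρ 2 hg
  rw [FluidPDE.laplacian_eq_sum_fderiv_fderiv b hQ x]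
  have h1 : ∀ i, (fun y => fderiv ℝ (fun x => ∫ z, k z * g (x - z)) y (b i)) =
      fun y => ∫ z, k z * (fun w => fderiv ℝ g w (b i)) (y - z) := fun i =>
    funext fun y => fderiv_integral_smul_comp_sub_apply hk hkρ hg1 y (b i)
  simp_rw [h1]
  have h2 : ∀ i, fderiv ℝ (fun y => ∫ z, k z * (fun w => fderiv ℝ g w (b i)) (y - z)) x (b i) =
      ∫ z, k z * fderiv ℝ (fun w => fderiv ℝ g w (b i)) (x - z) (b i) := fun i =>
    fderiv_integral_smul_comp_sub_apply hk hkρ (hgi i) x (b i)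
  simp_rw [h2]
  rw [← integral_finsetSum]
  · refine integral_congr_ae (Eventually.of_forall fun z => ?_)
    dsimp only
    rw [← Finset.mul_sum, FluidPDE.laplacian_eq_sum_fderiv_fderiv b hg (x - z)]
  · intro i _
    have := integrable_smul_comp_sub hk hkρ ((hgi i).continuous_fderiv one_ne_zero) x
    exact ((ContinuousLinearMap.apply ℝ ℝ (b i)).integrable_comp this).congr
      (Eventually.of_forall fun z => by simp)

end KernelSmooth

/-! ### Unit-mass radial bumps and their dilations -/

section Bump

variable {E : Type*} [NormedAddCommGroup E] [InnerProductSpace ℝ E] [FiniteDimensional ℝ E]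
  [MeasurableSpace E] [BorelSpace E]

/-- The base radial bump `θ = taoCutoff 2 1` (`= 1` on `|x| ≤ 1`, `= 0` on `|x| ≥ 2`, smooth,
values in `[0, 1]`, a function of `|x|`). [folklore] -/
def baseBump (x : E) : ℝ := taoCutoff 2 1 x

/-- The mass `m = ∫ θ` of the base bump. [folklore] -/
def baseBumpMass (E : Type*) [NormedAddCommGroup E] [InnerProductSpace ℝ E]
    [FiniteDimensional ℝ E] [MeasurableSpace E] [BorelSpace E] : ℝ :=
  ∫ x : E, baseBump x

/-- **The unit-mass radial bump at scale `R`**: `χ_R(x) = (m R^d)⁻¹ θ(R⁻¹ x)` (`d = dim E`),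
smooth, radial, supported in `|x| ≤ 2R`, with `∫ χ_R = 1` for `R > 0` — the test function
`R⁻³χ(x/R)` of Tao 2011, §4, proof of Lemma 4.1 (junk for `R ≤ 0`). Not Mathlib's
`ContDiffBump.normed`: the explicit dilation structure is what the derivative scalings
`fderiv_probeBump_apply`, `abs_laplacian_probeBump_le` use, and radiality must be provable. [folklore] -/
def probeBump (R : ℝ) (x : E) : ℝ :=
  (baseBumpMass E * R ^ Module.finrank ℝ E)⁻¹ * baseBump (R⁻¹ • x)

omit [FiniteDimensional ℝ E] [MeasurableSpace E] [BorelSpace E] [InnerProductSpace ℝ E] in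
/-- `0 ≤ θ ≤ 1`. [folklore] -/
theorem baseBump_mem_Icc (x : E) : baseBump x ∈ Icc (0 : ℝ) 1 :=
  ⟨taoCutoff_nonneg _ _ _, taoCutoff_le_one _ _ _⟩

omit [FiniteDimensional ℝ E] [MeasurableSpace E] [BorelSpace E] [InnerProductSpace ℝ E] in
/-- `θ` is radial. [folklore] -/
theorem baseBump_radial {x y : E} (h : ‖x‖ = ‖y‖) : baseBump x = baseBump y := by
  simp [baseBump, taoCutoff_apply, h]

omit [FiniteDimensional ℝ E] [MeasurableSpace E] [BorelSpace E] [InnerProductSpace ℝ E] in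
/-- `θ = 1` on the closed unit ball. [folklore] -/
theorem baseBump_eq_one {x : E} (hx : ‖x‖ ≤ 1) : baseBump x = 1 :=
  taoCutoff_eq_one_of_norm_le two_pos one_pos one_le_two (by norm_num; exact hx)

omit [FiniteDimensional ℝ E] [MeasurableSpace E] [BorelSpace E] [InnerProductSpace ℝ E] in
/-- `θ = 0` off the open ball of radius `2`. [folklore] -/
theorem baseBump_eq_zero {x : E} (hx : 2 ≤ ‖x‖) : baseBump x = 0 :=
  taoCutoff_eq_zero zero_le_two zero_le_one hx

omit [FiniteDimensional ℝ E] [MeasurableSpace E] [BorelSpace E] in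
/-- `θ` is smooth. [folklore] -/
theorem contDiff_baseBump {n : ℕ∞} : ContDiff ℝ n (baseBump : E → ℝ) :=
  contDiff_taoCutoff 2 1

omit [MeasurableSpace E] [BorelSpace E] in
/-- `θ` has compact support. [folklore] -/
theorem hasCompactSupport_baseBump : HasCompactSupport (baseBump : E → ℝ) :=
  hasCompactSupport_taoCutoff zero_le_two zero_le_one

/-- `θ` is integrable. [folklore] -/
theorem integrable_baseBump : Integrable (baseBump : E → ℝ) :=
  (contDiff_baseBump (n := 0)).continuous.integrable_of_hasCompactSupport hasCompactSupport_baseBump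

/-- **`m = ∫ θ > 0`** (`θ ≥ 0` everywhere and `θ = 1` on the unit ball, which has positive
measure). [folklore] -/
theorem baseBumpMass_pos : 0 < baseBumpMass E := by
  have hle : ∫ x, (closedBall (0 : E) 1).indicator (fun _ => (1 : ℝ)) x ≤ baseBumpMass E := by
    refine integral_mono ((integrable_indicator_iff measurableSet_closedBall).2
      (integrableOn_const measure_closedBall_lt_top.ne)) integrable_baseBump fun x => ?_
    by_cases hx : x ∈ closedBall (0 : E) 1
    · rw [indicator_of_mem hx, baseBump_eq_one (mem_closedBall_zero_iff.1 hx)]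
    · rw [indicator_of_notMem hx]; exact (baseBump_mem_Icc x).1
  have hpos : 0 < ∫ x, (closedBall (0 : E) 1).indicator (fun _ => (1 : ℝ)) x := by
    rw [integral_indicator measurableSet_closedBall, setIntegral_const, smul_eq_mul, mul_one,
      measureReal_def]
    exact ENNReal.toReal_pos (Metric.measure_closedBall_pos volume (0 : E) one_pos).ne'
      measure_closedBall_lt_top.ne
  exact hpos.trans_le hle

variable {R : ℝ}

/-- `χ_R` is smooth (any `R`; for `R = 0` it is the junk constant `θ(0)/0`). [folklore] -/
theorem contDiff_probeBump (R : ℝ) {n : ℕ∞} : ContDiff ℝ n (probeBump (E := E) R) :=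
  contDiff_const.mul (contDiff_baseBump.comp (contDiff_const_smul _))

/-- `χ_R` is radial. [folklore] -/
theorem probeBump_radial (R : ℝ) {x y : E} (h : ‖x‖ = ‖y‖) : probeBump R x = probeBump R y := by
  simp only [probeBump]
  congr 1
  exact baseBump_radial (by simp [norm_smul, h])

/-- `χ_R` is even. [folklore] -/
theorem probeBump_neg (R : ℝ) (x : E) : probeBump R (-x) = probeBump R x :=
  probeBump_radial R (norm_neg x)

/-- `0 ≤ χ_R` (`R > 0`). [folklore] -/
theorem probeBump_nonneg (hR : 0 < R) (x : E) : 0 ≤ probeBump R x :=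
  mul_nonneg (inv_nonneg.2 (mul_nonneg baseBumpMass_pos.le (pow_nonneg hR.le _)))
    (baseBump_mem_Icc _).1

/-- `|χ_R| ≤ (m R^d)⁻¹` (`R > 0`). [folklore] -/
theorem abs_probeBump_le (hR : 0 < R) (x : E) :
    |probeBump R x| ≤ (baseBumpMass E * R ^ Module.finrank ℝ E)⁻¹ := by
  rw [abs_of_nonneg (probeBump_nonneg hR x), probeBump]
  exact mul_le_of_le_one_right (inv_nonneg.2 (mul_nonneg baseBumpMass_pos.le (pow_nonneg hR.le _)))
    (baseBump_mem_Icc _).2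

/-- `χ_R = 0` for `|x| ≥ 2R` (`R > 0`). [folklore] -/
theorem probeBump_eq_zero (hR : 0 < R) {x : E} (hx : 2 * R ≤ ‖x‖) : probeBump R x = 0 := by
  rw [probeBump, baseBump_eq_zero, mul_zero]
  rw [norm_smul, norm_inv, Real.norm_eq_abs, abs_of_pos hR, le_inv_mul_iff₀ hR]
  linarith

/-- The topological support of `χ_R` lies in the closed ball of radius `2R`. [folklore] -/
theorem tsupport_probeBump_subset (hR : 0 < R) :
    tsupport (probeBump (E := E) R) ⊆ closedBall (0 : E) (2 * R) := by
  refine closure_minimal (fun x hx => ?_) isClosed_closedBall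
  rw [mem_closedBall_zero_iff]
  by_contra h
  exact hx (probeBump_eq_zero hR (not_le.1 h).le)

/-- `χ_R` has compact support. [folklore] -/
theorem hasCompactSupport_probeBump (hR : 0 < R) : HasCompactSupport (probeBump (E := E) R) :=
  (isCompact_closedBall (0 : E) (2 * R)).of_isClosed_subset isClosed_closure
    (tsupport_probeBump_subset hR)

/-- `χ_R` is integrable. [folklore] -/
theorem integrable_probeBump (hR : 0 < R) : Integrable (probeBump (E := E) R) :=
  (contDiff_probeBump R (n := 0)).continuous.integrable_of_hasCompactSupport
    (hasCompactSupport_probeBump hR)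

/-- **`∫ χ_R = 1`.** [folklore] -/
theorem integral_probeBump (hR : 0 < R) : ∫ x : E, probeBump R x = 1 := by
  simp only [probeBump]
  rw [integral_const_mul, Measure.integral_comp_inv_smul_of_nonneg volume baseBump hR.le,
    smul_eq_mul]
  have hm : baseBumpMass E ≠ 0 := baseBumpMass_pos.ne'
  have hRd : R ^ Module.finrank ℝ E ≠ 0 := pow_ne_zero _ hR.ne'
  rw [show (∫ x : E, baseBump x) = baseBumpMass E from rfl]
  field_simp

/-- **The derivative of `χ_R`**: `Dχ_R(x) a = (m R^{d+1})⁻¹ Dθ(R⁻¹x) a`. [folklore] -/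
theorem fderiv_probeBump_apply (hR : 0 < R) (x a : E) :
    fderiv ℝ (probeBump R) x a = (baseBumpMass E * R ^ Module.finrank ℝ E)⁻¹ * R⁻¹ *
      fderiv ℝ baseBump (R⁻¹ • x) a := by
  have h : probeBump (E := E) R = fun x => (baseBumpMass E * R ^ Module.finrank ℝ E)⁻¹ •
      baseBump (R⁻¹ • x) := rfl
  rw [h, fderiv_const_smul_comp_smul _ _ (inv_ne_zero hR.ne')]
  simp [mul_assoc]

/-- **Uniform bound for `Dχ_R`**: `‖Dχ_R(x)‖ ≤ (m R^{d+1})⁻¹ sup‖Dθ‖`. [folklore] -/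
theorem norm_fderiv_probeBump_le (hR : 0 < R) {C : ℝ} (hC : ∀ x : E, ‖fderiv ℝ baseBump x‖ ≤ C)
    (x : E) : ‖fderiv ℝ (probeBump R) x‖ ≤ (baseBumpMass E * R ^ Module.finrank ℝ E)⁻¹ * R⁻¹ * C := by
  have h : probeBump (E := E) R = fun x => (baseBumpMass E * R ^ Module.finrank ℝ E)⁻¹ •
      baseBump (R⁻¹ • x) := rfl
  have hm := baseBumpMass_pos (E := E)
  rw [h, fderiv_const_smul_comp_smul _ _ (inv_ne_zero hR.ne')]
  dsimp only
  rw [norm_smul, Real.norm_eq_abs, abs_of_pos (by positivity)]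
  exact mul_le_mul_of_nonneg_left (hC _) (by positivity)

/-- **Uniform bound for `Δχ_R`**: `|Δχ_R(x)| ≤ (m R^{d+2})⁻¹ sup|Δθ|`. [folklore] -/
theorem abs_laplacian_probeBump_le (hR : 0 < R) {C : ℝ}
    (hC : ∀ x : E, |(Δ (baseBump : E → ℝ)) x| ≤ C) (x : E) :
    |(Δ (probeBump R : E → ℝ)) x| ≤ (baseBumpMass E * R ^ Module.finrank ℝ E)⁻¹ * R⁻¹ ^ 2 * C := by
  have hm := baseBumpMass_pos (E := E)
  have h : probeBump (E := E) R = fun x => (baseBumpMass E * R ^ Module.finrank ℝ E)⁻¹ •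
      baseBump (R⁻¹ • x) := rfl
  rw [h, laplacian_const_smul_comp_smul _ _ (inv_ne_zero hR.ne'), smul_eq_mul, abs_mul,
    abs_of_pos (by positivity : (0 : ℝ) < (baseBumpMass E * R ^ Module.finrank ℝ E)⁻¹ * R⁻¹ ^ 2)]
  exact mul_le_mul_of_nonneg_left (hC _) (by positivity)

omit [MeasurableSpace E] [BorelSpace E] in
/-- Bounds for `Dθ` and `Δθ` exist (continuous with compact support). [folklore] -/
theorem exists_bound_baseBump_derivs :
    (∃ C, ∀ x : E, ‖fderiv ℝ baseBump x‖ ≤ C) ∧ ∃ C, ∀ x : E, |(Δ (baseBump : E → ℝ)) x| ≤ C := by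
  refine ⟨?_, ?_⟩
  · exact ((contDiff_baseBump (n := 1)).continuous_fderiv one_ne_zero).bounded_above_of_compact_support
      (hasCompactSupport_baseBump.fderiv (𝕜 := ℝ))
  · have hc : HasCompactSupport (Δ (baseBump : E → ℝ)) :=
      (hasCompactSupport_baseBump (E := E)).mono' fun x hx => by
        contrapose! hx
        simp [FluidPDE.laplacian_eq_zero_of_notMem_tsupport hx]
    obtain ⟨C, hC⟩ := (FluidPDE.continuous_laplacian (contDiff_baseBump (E := E) (n := 2)))
      |>.bounded_above_of_compact_support hc
    exact ⟨C, fun x => by rw [← Real.norm_eq_abs]; exact hC x⟩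

end Bump

/-! ### The mean-value formula for the gradient of a harmonic function -/

section Gradient

variable {E : Type*} [NormedAddCommGroup E] [InnerProductSpace ℝ E] [FiniteDimensional ℝ E]
  [MeasurableSpace E] [BorelSpace E]

/-- **Integration by parts against a reflected translate**: for `χ ∈ C¹_c(E)`, `F ∈ C¹(E; ℝ)`,
`∫ ∂ₐχ(z) F(y - z) dz = ∫ χ(z) ∂ₐF(y - z) dz` (the sign of the chain rule for `z ↦ y - z`
cancels the sign of the integration by parts). [folklore] -/
theorem integral_fderiv_mul_comp_sub {χ F : E → ℝ} (hχ : ContDiff ℝ 1 χ) (hc : HasCompactSupport χ)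
    (hF : ContDiff ℝ 1 F) (y a : E) :
    ∫ z, fderiv ℝ χ z a * F (y - z) = ∫ z, χ z * fderiv ℝ F (y - z) a := by
  have hFy : ContDiff ℝ 1 fun z => F (y - z) := hF.comp (contDiff_const.sub contDiff_id)
  have hP : ContDiff ℝ 1 fun z => χ z * F (y - z) := hχ.mul hFy
  have hPc : HasCompactSupport fun z => χ z * F (y - z) := hc.mul_right
  have h0 := FluidPDE.integral_fderiv_apply_eq_zero hP hPc a
  have hpt : ∀ z, fderiv ℝ (fun z => χ z * F (y - z)) z a =
      fderiv ℝ χ z a * F (y - z) - χ z * fderiv ℝ F (y - z) a := fun z => by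
    rw [fderiv_fun_mul (hχ.differentiable one_ne_zero z) (hFy.differentiable one_ne_zero z),
      fderiv_comp_const_sub]
    simp only [_root_.add_apply, _root_.FunLike.coe_smul, Pi.smul_apply,
      smul_eq_mul, _root_.neg_apply]
    ring
  simp_rw [hpt] at h0
  have i1 : Integrable fun z => fderiv ℝ χ z a * F (y - z) :=
    (((hχ.continuous_fderiv one_ne_zero).clm_apply continuous_const).mul hFy.continuous)
      |>.integrable_of_hasCompactSupport (hc.fderiv_apply (𝕜 := ℝ) a).mul_right
  have i2 : Integrable fun z => χ z * fderiv ℝ F (y - z) a :=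
    (hχ.continuous.mul ((hF.continuous_fderiv one_ne_zero).clm_apply continuous_const |>.comp
      (continuous_const.sub continuous_id))).integrable_of_hasCompactSupport hc.mul_right
  rw [integral_sub i1 i2] at h0
  linarith

/-- **Mean value property against the bumps**: for `η` harmonic on `E`,
`η(y) = ∫ χ_R(z) η(y - z) dz` for every `y` and `R > 0`. [cite: GilbargTrudinger2001, Thm 2.1] -/
theorem integral_probeBump_mul_comp_sub {η : E → ℝ} (hη : HarmonicOnNhd η univ) {R : ℝ}
    (hR : 0 < R) (y : E) : ∫ z, probeBump R z * η (y - z) = η y := by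
  have h := integral_radial_mul_harmonic hη (contDiff_probeBump R (n := 0)).continuous
    (hasCompactSupport_probeBump hR) (fun x y h => probeBump_radial R h) y
  rw [integral_probeBump hR, one_mul] at h
  rw [← h, ← integral_neg_eq_self (fun z => probeBump R z * η (y - z)) volume]
  refine integral_congr_ae (Eventually.of_forall fun z => ?_)
  simp only [probeBump_neg, sub_neg_eq_add]

/-- **The mean-value formula for the gradient (Gilbarg–Trudinger Thm 2.1 / (2.19); the step
`∫∫ ∇h χ_R = ∫ ∇h(t,0) dt` of Tao 2011, §4).** For `η` harmonic on `E`, every `R > 0`, every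
centre `y` and direction `a`: `Dη(y) a = ∫ ∂ₐχ_R(z) η(y - z) dz`. [cite: GilbargTrudinger2001, Thm 2.1] -/
theorem fderiv_harmonic_eq_integral_probeBump {η : E → ℝ} (hη : HarmonicOnNhd η univ) {R : ℝ}
    (hR : 0 < R) (y a : E) :
    fderiv ℝ η y a = ∫ z, fderiv ℝ (probeBump R) z a * η (y - z) := by
  haveI : CompleteSpace E := FiniteDimensional.complete ℝ E
  have hη2 : ContDiff ℝ 2 η := contDiff_two_of_harmonicOnNhd_univ hη
  have hη1 : ContDiff ℝ 1 η := hη2.of_le one_le_two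
  -- `η = χ_R * η` as functions
  have hH : η = fun y => ∫ z, probeBump R z • η (y - z) := by
    funext y
    rw [← integral_probeBump_mul_comp_sub hη hR y]
    rfl
  -- differentiate under the integral, then integrate by parts
  have hD := fderiv_integral_smul_comp_sub_apply (integrable_probeBump hR)
    (fun z hz => probeBump_eq_zero hR hz.le) hη1 y a
  rw [← hH] at hD
  rw [hD]
  simp only [smul_eq_mul]
  exact (integral_fderiv_mul_comp_sub (contDiff_probeBump R) (hasCompactSupport_probeBump hR)
    hη1 y a).symm

end Gradient

/-! ### A real-variable uniqueness lemma -/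

section Real

/-- **Uniform approximation by continuous functions (metric form).** If for every `ε > 0`
there is `F` continuous on `s` with `dist (f y) (F y) ≤ ε` on `s`, then `f` is continuous on `s`
(Mathlib `continuousOn_of_uniform_approx_of_continuousOn`). [folklore] -/
theorem continuousOn_of_approx {α β : Type*} [TopologicalSpace α] [PseudoMetricSpace β]
    {f : α → β} {s : Set α}
    (h : ∀ ε > 0, ∃ F, ContinuousOn F s ∧ ∀ y ∈ s, dist (f y) (F y) ≤ ε) : ContinuousOn f s := by
  refine continuousOn_of_uniform_approx_of_continuousOn fun u hu => ?_
  obtain ⟨ε, hε, hεu⟩ := Metric.mem_uniformity_dist.1 hu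
  obtain ⟨F, hF, hFε⟩ := h (ε / 2) (half_pos hε)
  exact ⟨F, hF, fun y hy => hεu ((hFε y hy).trans_lt (half_lt_self hε))⟩

/-- **Uniqueness lemma.** Let `g : ℝ → ℝ` and `a < b`. Suppose that for every `ε > 0` there are
`W, W' : ℝ → ℝ` with `W'` continuous on `(a, b)`, `W` differentiable with derivative `W'` on
`(a, b)`, `|W| ≤ ε` and `|g + W'| ≤ ε` on `(a, b)`. Then `g = 0` on `(a, b)`.
(Then `g` is continuous, `∫_{t₁}^{t₂} g = lim (W(t₁) - W(t₂)) = 0` for all `t₁ < t₂`, hence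
`g ≡ 0`; this is how "`∫_{t₁}^{t₂} ∇h(t,0) dt = 0` for all `t₁, t₂`" concludes Tao's proof of
Lemma 4.1 (i), with the `o(1)` boundary terms made explicit.) [folklore] -/
theorem eq_zero_of_approx_antiderivative {g : ℝ → ℝ} {a b : ℝ}
    (h : ∀ ε > 0, ∃ W W' : ℝ → ℝ, ContinuousOn W' (Ioo a b) ∧
      (∀ t ∈ Ioo a b, HasDerivAt W (W' t) t) ∧ (∀ t ∈ Ioo a b, |W t| ≤ ε) ∧
      ∀ t ∈ Ioo a b, |g t + W' t| ≤ ε) :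
    ∀ t ∈ Ioo a b, g t = 0 := by
  intro t₀ ht₀
  have hab : a < b := ht₀.1.trans ht₀.2
  -- `g` is continuous on `(a, b)`
  have hg : ContinuousOn g (Ioo a b) := by
    refine continuousOn_of_approx fun ε hε => ?_
    obtain ⟨W, W', hW'c, -, -, hgW⟩ := h ε hε
    refine ⟨fun t => -W' t, hW'c.neg, fun y hy => ?_⟩
    rw [Real.dist_eq, sub_neg_eq_add]
    exact hgW y hy
  -- the antiderivative `G(s) = ∫_{t₀}^{s} g`
  set G : ℝ → ℝ := fun s => ∫ τ in t₀..s, g τ with hG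
  have hGd : ∀ s ∈ Ioo a b, HasDerivAt G (g s) s := by
    intro s hs
    have hsub : uIcc t₀ s ⊆ Ioo a b := ordConnected_Ioo.uIcc_subset ht₀ hs
    exact intervalIntegral.integral_hasDerivAt_right ((hg.mono hsub).intervalIntegrable)
      (hg.stronglyMeasurableAtFilter isOpen_Ioo s hs) (hg.continuousAt (isOpen_Ioo.mem_nhds hs))
  -- `G` is constant on `(a, b)`
  have hGc : ∀ s₁ ∈ Ioo a b, ∀ s₂ ∈ Ioo a b, G s₁ = G s₂ := by
    intro s₁ hs₁ s₂ hs₂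
    have key : ∀ ε > 0, |G s₂ - G s₁| ≤ (b - a + 2) * ε := by
      intro ε hε
      obtain ⟨W, W', -, hWd, hWb, hgW⟩ := h ε hε
      have hI : uIcc s₁ s₂ ⊆ Ioo a b := ordConnected_Ioo.uIcc_subset hs₁ hs₂
      have hΦ : ∀ x ∈ uIcc s₁ s₂,
          HasDerivWithinAt (fun s => G s + W s) (g x + W' x) (uIcc s₁ s₂) x := fun x hx =>
        ((hGd x (hI hx)).add (hWd x (hI hx))).hasDerivWithinAt
      have hbound : ∀ x ∈ uIcc s₁ s₂, ‖g x + W' x‖ ≤ ε := fun x hx => by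
        rw [Real.norm_eq_abs]; exact hgW x (hI hx)
      have hmvt := Convex.norm_image_sub_le_of_norm_hasDerivWithin_le hΦ hbound (convex_uIcc s₁ s₂)
        left_mem_uIcc right_mem_uIcc
      rw [Real.norm_eq_abs, Real.norm_eq_abs] at hmvt
      have hs : |s₂ - s₁| ≤ b - a := by
        rw [abs_le]; constructor <;> linarith [hs₁.1, hs₁.2, hs₂.1, hs₂.2]
      have h1 := hWb s₁ hs₁
      have h2 := hWb s₂ hs₂
      calc |G s₂ - G s₁| = |((G s₂ + W s₂) - (G s₁ + W s₁) - W s₂) + W s₁| := by ring_nf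
        _ ≤ |(G s₂ + W s₂) - (G s₁ + W s₁) - W s₂| + |W s₁| := abs_add_le _ _
        _ ≤ |(G s₂ + W s₂) - (G s₁ + W s₁)| + |W s₂| + |W s₁| := by
            gcongr; exact abs_sub _ _
        _ ≤ ε * |s₂ - s₁| + ε + ε := by gcongr
        _ ≤ ε * (b - a) + ε + ε := by gcongr
        _ = (b - a + 2) * ε := by ring
    by_contra hne
    have hpos : 0 < |G s₂ - G s₁| := abs_pos.2 (sub_ne_zero.2 (Ne.symm hne))
    have hba : 0 < b - a + 2 := by linarith
    have hk := key (|G s₂ - G s₁| / (2 * (b - a + 2))) (by positivity)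
    have : (b - a + 2) * (|G s₂ - G s₁| / (2 * (b - a + 2))) = |G s₂ - G s₁| / 2 := by
      field_simp
    rw [this] at hk
    linarith
  -- hence its derivative `g(t₀)` vanishes
  have hconst : G =ᶠ[𝓝 t₀] fun _ => G t₀ := by
    filter_upwards [isOpen_Ioo.mem_nhds ht₀] with s hs using hGc s hs t₀ ht₀
  exact (hGd t₀ ht₀).unique ((hasDerivAt_const t₀ (G t₀)).congr_of_eventuallyEq hconst)

end Real

end Literature.Analysis.FluidPDE

end
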